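import Mathlib
import Literature.Analysis.FluidPDE.SuitableWeak
import Literature.Analysis.FluidPDE.SuitableWeakCongr
import Summits.NavierStokesRegularity.NavierStokesRegularity.Theorems.EulerZoomLiouvillePowerGaugeEulerLiouvillePastSteady
import HarnessLib

/-!
# Crux `EulerZoomLiouville.PowerGaugeEulerLiouville` (stmt-NavierStokesRegularity-19832), stub `stub_nonSelfSimilarRest`:
# members that are STEADY ALMOST EVERYWHERE on a past slab are trivial

Helper file (theorems only; `--supports stmt-NavierStokesRegularity-19832`; def-free).  Hand leafhand-ns-eulerzoomliouville-10 g3.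

The tree's `PastSteady.ae_eq_zero_of_gauge_of_pastSteady` kills members with `u(τ, ·) = v` for EVERY `τ < T₁` (literal equality of slices).  The
class sees `u` only through integrals, except for the genuine `sup` in the `A`-gauge; so the natural hypothesis delivered by distributional
arguments (e.g. the wrong-parity sector: `∂ₜu = 0` in `𝒟'`, then a.e. steadiness) is the ALMOST-EVERYWHERE one,
`u(τ, x) = U(x)` for a.e. `(τ, x) ∈ (−∞, T₁) × ℝ³`.  This file bridges the gap (`AePastSteady.ae_eq_zero_of_gauge_of_aePastSteady`): the modified
field `v = U` on `τ < T₁`, `v = u` after, equals `u` a.e. on the slab, so it is again a suitable weak Euler pair with the same weak gradient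
(`IsSuitableWeakSolutionOn.congr_ae`, `HasWeakSpatialGradientOn.congr_ae`), its `E`- and `D`-gauges are those of `u`, and its `A`-gauge is AT MOST
that of `u` (a past slice of `v` is `U`, which is an a.e. slice `u(τ₀)` of `u` inside the same parabolic window); the literal past-steady theorem
then kills `v`, hence `u`.

WHAT THIS IS NOT: not a proof of the stub or of the crux; nothing about Navier–Stokes. [folklore]
-/

noncomputable section

-- flat `Theorems/<Route><Decl>…` files of one crux share the namespace of the crux (tree convention)
set_option linter.dupNamespace false

open MeasureTheory Set Filter Topology Metric Function TopologicalSpace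
open scoped RealInnerProductSpace NNReal ENNReal

namespace Summit.NavierStokesRegularity.NavierStokesRegularity.Theorems.PowerGaugeEulerLiouville

open Literature.Analysis Literature.Analysis.FunctionSpaces Literature.Analysis.FluidPDE

namespace AePastSteady

/-- From an a.e. identity on the past slab to a.e. slices: for a.e. `τ < T₁`, `u(τ) = U` a.e. on `ℝ³`. [folklore] -/
theorem ae_slice_eq_of_ae_slab {u : ℝ → EuclideanSpace ℝ (Fin 3) → EuclideanSpace ℝ (Fin 3)}
    {U : EuclideanSpace ℝ (Fin 3) → EuclideanSpace ℝ (Fin 3)} {T₁ : ℝ}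
    (hU : ∀ᵐ z ∂(volume.restrict (Iio T₁ ×ˢ (univ : Set (EuclideanSpace ℝ (Fin 3))))), u z.1 z.2 = U z.2) :
    ∀ᵐ τ ∂(volume.restrict (Iio T₁)), u τ =ᵐ[volume] U := by
  have e : (volume.restrict (Iio T₁ ×ˢ (univ : Set (EuclideanSpace ℝ (Fin 3)))) : Measure (ℝ × EuclideanSpace ℝ (Fin 3))) =
      ((volume : Measure ℝ).restrict (Iio T₁)).prod (volume : Measure (EuclideanSpace ℝ (Fin 3))) := by
    rw [Measure.volume_eq_prod, ← Measure.restrict_univ (μ := (volume : Measure (EuclideanSpace ℝ (Fin 3)))),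
      Measure.prod_restrict, Measure.restrict_univ]
  rw [e] at hU
  have h := Measure.ae_ae_of_ae_prod hU
  filter_upwards [h] with τ hτ
  filter_upwards [hτ] with x hx
  exact hx

/-- The `A`-quantity of the modified field (`U` before `T₁`, `u` after) is at most that of `u`, provided a.e. slice of `u` before `T₁` is `U`.
[folklore] -/
theorem cknA_modified_le {u : ℝ → EuclideanSpace ℝ (Fin 3) → EuclideanSpace ℝ (Fin 3)}
    {U : EuclideanSpace ℝ (Fin 3) → EuclideanSpace ℝ (Fin 3)} {T₁ : ℝ}
    (hslice : ∀ᵐ τ ∂(volume.restrict (Iio T₁)), u τ =ᵐ[volume] U) (a : ℝ) :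
    cknA a (0 : ℝ × EuclideanSpace ℝ (Fin 3)) (fun τ x => if τ < T₁ then U x else u τ x) ≤
      cknA a (0 : ℝ × EuclideanSpace ℝ (Fin 3)) u := by
  unfold cknA
  refine iSup₂_le fun t ht => ?_
  by_cases htT : t < T₁
  · -- a past slice: `v t = U = u τ₀` a.e. for some `τ₀` in the same window
    have hwin : volume (Ioo ((0 : ℝ × EuclideanSpace ℝ (Fin 3)).1 - a ^ 2) t) ≠ 0 := by
      rw [Real.volume_Ioo]
      have : (0 : ℝ × EuclideanSpace ℝ (Fin 3)).1 - a ^ 2 < t := ht.1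
      exact (ENNReal.ofReal_pos.2 (by linarith)).ne'
    have hsub : Ioo ((0 : ℝ × EuclideanSpace ℝ (Fin 3)).1 - a ^ 2) t ⊆ Iio T₁ := fun τ hτ => lt_trans hτ.2 htT
    obtain ⟨τ₀, hτ₀, hτ₀U⟩ := Measure.exists_mem_of_measure_ne_zero_of_ae hwin (ae_restrict_of_ae_restrict_of_subset hsub hslice)
    have hτ₀win : τ₀ ∈ Ioo ((0 : ℝ × EuclideanSpace ℝ (Fin 3)).1 - a ^ 2) (0 : ℝ × EuclideanSpace ℝ (Fin 3)).1 :=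
      ⟨hτ₀.1, lt_trans hτ₀.2 ht.2⟩
    have e1 : ∫⁻ x in ball (0 : ℝ × EuclideanSpace ℝ (Fin 3)).2 a, ‖(fun τ x => if τ < T₁ then U x else u τ x) t x‖ₑ ^ 2 =
        ∫⁻ x in ball (0 : ℝ × EuclideanSpace ℝ (Fin 3)).2 a, ‖u τ₀ x‖ₑ ^ 2 := by
      refine lintegral_congr_ae (ae_restrict_of_ae ?_)
      filter_upwards [hτ₀U] with x hx
      simp only [if_pos htT, hx]
    rw [e1]
    exact le_iSup₂ (f := fun τ (_ : τ ∈ Ioo ((0 : ℝ × EuclideanSpace ℝ (Fin 3)).1 - a ^ 2) (0 : ℝ × EuclideanSpace ℝ (Fin 3)).1) =>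
      (ENNReal.ofReal a)⁻¹ * ∫⁻ x in ball (0 : ℝ × EuclideanSpace ℝ (Fin 3)).2 a, ‖u τ x‖ₑ ^ 2) τ₀ hτ₀win
  · have e1 : ∫⁻ x in ball (0 : ℝ × EuclideanSpace ℝ (Fin 3)).2 a, ‖(fun τ x => if τ < T₁ then U x else u τ x) t x‖ₑ ^ 2 =
        ∫⁻ x in ball (0 : ℝ × EuclideanSpace ℝ (Fin 3)).2 a, ‖u t x‖ₑ ^ 2 := by
      refine lintegral_congr fun x => ?_
      simp only [if_neg htT]
    rw [e1]
    exact le_iSup₂ (f := fun τ (_ : τ ∈ Ioo ((0 : ℝ × EuclideanSpace ℝ (Fin 3)).1 - a ^ 2) (0 : ℝ × EuclideanSpace ℝ (Fin 3)).1) =>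
      (ENNReal.ofReal a)⁻¹ * ∫⁻ x in ball (0 : ℝ × EuclideanSpace ℝ (Fin 3)).2 a, ‖u τ x‖ₑ ^ 2) t ht

/-- **MEMBERS THAT ARE STEADY A.E. ON A PAST SLAB ARE TRIVIAL.**  Let `(u, p)` be a suitable weak Euler pair on `(−∞,0) × ℝ³` with weak spatial
gradient `H` and gauges `a^{2ρ} A(a) + a^{ρ} E(a) + a^{2ρ} D(a) ≤ c` (`ρ > 0`), and suppose `u(τ, x) = U(x)` for a.e. `(τ, x) ∈ (−∞, T₁) × ℝ³`, some
`T₁ ≤ 0` and some `U : ℝ³ → ℝ³` (no regularity or decay assumed).  Then `u = 0` a.e. on the slab: the modified field (`U` before `T₁`, `u` after) is a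
member (a.e.-invariance of the class, `A`-gauge at most that of `u`) which is literally steady in the past, so the tree's
`PastSteady.ae_eq_zero_of_gauge_of_pastSteady` applies. [folklore] -/
theorem ae_eq_zero_of_gauge_of_aePastSteady {ρ : ℝ} (hρ : 0 < ρ)
    {u : ℝ → EuclideanSpace ℝ (Fin 3) → EuclideanSpace ℝ (Fin 3)} {p : ℝ → EuclideanSpace ℝ (Fin 3) → ℝ}
    {H : ℝ → EuclideanSpace ℝ (Fin 3) → EuclideanSpace ℝ (Fin 3) →L[ℝ] EuclideanSpace ℝ (Fin 3)} {c : ℝ≥0}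
    (hsw : IsSuitableWeakSolutionOn (slab (EuclideanSpace ℝ (Fin 3)) (Iio 0) isOpen_Iio) 0 0 u p)
    (hH : HasWeakSpatialGradientOn (slab (EuclideanSpace ℝ (Fin 3)) (Iio 0) isOpen_Iio) u H)
    (hc : ∀ a : ℝ, 0 < a → ENNReal.ofReal (a ^ (2 * ρ)) * cknA a (0 : ℝ × EuclideanSpace ℝ (Fin 3)) u +
        ENNReal.ofReal (a ^ ρ) * cknE a (0 : ℝ × EuclideanSpace ℝ (Fin 3)) H +
        ENNReal.ofReal (a ^ (2 * ρ)) * cknD a (0 : ℝ × EuclideanSpace ℝ (Fin 3)) p ≤ (c : ℝ≥0∞))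
    {T₁ : ℝ} (hT₁ : T₁ ≤ 0) {U : EuclideanSpace ℝ (Fin 3) → EuclideanSpace ℝ (Fin 3)}
    (hU : ∀ᵐ z ∂(volume.restrict (Iio T₁ ×ˢ (univ : Set (EuclideanSpace ℝ (Fin 3))))), u z.1 z.2 = U z.2) :
    uncurry u =ᵐ[volume.restrict (Iio (0 : ℝ) ×ˢ (univ : Set (EuclideanSpace ℝ (Fin 3))))] 0 := by
  classical
  set v : ℝ → EuclideanSpace ℝ (Fin 3) → EuclideanSpace ℝ (Fin 3) := fun τ x => if τ < T₁ then U x else u τ x with hv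
  -- (1) `v = u` a.e. on the slab
  have hvu : ∀ᵐ z ∂(volume.restrict ((slab (EuclideanSpace ℝ (Fin 3)) (Iio 0) isOpen_Iio : Opens (ℝ × EuclideanSpace ℝ (Fin 3))) :
      Set (ℝ × EuclideanSpace ℝ (Fin 3)))), uncurry u z = uncurry v z := by
    rw [coe_slab]
    have h1 : ∀ᵐ z ∂(volume.restrict (Iio (0 : ℝ) ×ˢ (univ : Set (EuclideanSpace ℝ (Fin 3))))),
        z ∈ Iio T₁ ×ˢ (univ : Set (EuclideanSpace ℝ (Fin 3))) → u z.1 z.2 = U z.2 :=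
      ae_restrict_of_ae (ae_imp_of_ae_restrict hU)
    filter_upwards [h1] with z hz
    by_cases ht : z.1 < T₁
    · simp only [uncurry, hv, if_pos ht]
      exact hz ⟨ht, mem_univ _⟩
    · simp only [uncurry, hv, if_neg ht]
  -- (2) `v` is a member with the same `p`, `H`
  have hsw' : IsSuitableWeakSolutionOn (slab (EuclideanSpace ℝ (Fin 3)) (Iio 0) isOpen_Iio) 0 0 v p :=
    hsw.congr_ae hvu (Eventually.of_forall fun _ => rfl)
  have hH' : HasWeakSpatialGradientOn (slab (EuclideanSpace ℝ (Fin 3)) (Iio 0) isOpen_Iio) v H := hH.congr_ae hvu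
  -- (3) gauges of `v`
  have hslice := ae_slice_eq_of_ae_slab hU
  have hc' : ∀ a : ℝ, 0 < a → ENNReal.ofReal (a ^ (2 * ρ)) * cknA a (0 : ℝ × EuclideanSpace ℝ (Fin 3)) v +
      ENNReal.ofReal (a ^ ρ) * cknE a (0 : ℝ × EuclideanSpace ℝ (Fin 3)) H +
      ENNReal.ofReal (a ^ (2 * ρ)) * cknD a (0 : ℝ × EuclideanSpace ℝ (Fin 3)) p ≤ (c : ℝ≥0∞) := by
    intro a ha
    refine le_trans ?_ (hc a ha)
    gcongr
    exact cknA_modified_le hslice a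
  -- (4) `v` is literally steady before `T₁`
  have hvU : ∀ τ : ℝ, τ < T₁ → v τ = U := fun τ hτ => funext fun x => if_pos hτ
  have h0 := PastSteady.ae_eq_zero_of_gauge_of_pastSteady hρ hsw' hH' hc' hT₁ hvU
  -- (5) back to `u`
  rw [coe_slab] at hvu
  filter_upwards [h0, hvu] with z hz hz'
  rw [hz']
  exact hz

end AePastSteady

end Summit.NavierStokesRegularity.NavierStokesRegularity.Theorems.PowerGaugeEulerLiouville

end
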